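import Literature.NumberTheory.GaloisCohomology.PoitouTateSumTotallyComplex
import Literature.NumberTheory.GaloisCohomology.PoitouTateNumberField
import Literature.NumberTheory.EllipticCurves.PoitouTateSelmerStructuresConj
import Literature.AnabelianGeometry.AbsoluteAnabelian.AbsAnabProp121viiHolds
import Literature.AlgebraicGeometry.Frobenioids.PadicKummerThm24iiFieldIso
import HarnessLib

/-!
# THE local invariant maps are compatible with the Galois transport of completions:
# `inv_{σv} ∘ σ_* = inv_v` on `H²(K_v, μ_N)` (Serre, Cassels–Fröhlich VI §1.1; Neukirch III §6)

Topic `NumberTheory/GaloisCohomology`; namespace `Literature.NumberTheory.GaloisCohomology`.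
PROOF FILE (theorems only: no definition, no named fact, no instance, no notation; D-0026).

The named fact `poitouTate_selmerStructure_duality_conj K`
(`EllipticCurves/PoitouTateSelmerStructuresConj.lean`) asserts, for every `N ≥ 1`, ONE family
`inv = (inv_v)_v` of local invariant maps `H²(K_v, μ_N) → ℤ/N` with FIVE printed properties of THE
invariant maps of local class field theory: `IsPerfect`, `SumLocalTermEqZero`, `UnramifiedOrthogonal`,
`SelmerComplement` and — the fifth — `IsConjCompatible σ` for every `σ ∈ Aut(K/ℚ)`:
`inv_{σv} (σ_* c) = inv_v c` for the semilinear transport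
`σ_* = muConjPlace σ N h 2 : H²(K_v, μ_N) → H²(K_{σv}, μ_N)` (`EllipticCurves/SemilinearTateDualPlaces.lean`).
For THE canonical family `LocalInvariants.canonical K N` (`ArchimedeanInvariantMap.lean`: the residue
maps `localInvariantMap K N v = invLevel (K_v) N ∘ (μ_N(K̄)| ≅ μ_N(K̄_v))` at the finite places) the
tree PROVES `IsPerfect` (`canonical_isPerfect`) and, for `K` totally complex, the reciprocity law
`SumInvLocalizationEqZero` (`sumInvLocalizationEqZero_canonical_of_correction` +
`exists_correction_trivial_above_p`, cell bsd-cn100).  THIS FILE PROVES THE FIFTH PROPERTY for the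
canonical family, for every number field `K : Type` and every `σ ∈ Aut(K/ℚ)`:

* `localInvariantMap_muConjPlace` — **`inv_w (σ_* c) = inv_v c`** for `σ • v = w`,
  `c ∈ H²(Γ_{K_v}, μ_N(K̄)|)`;
* `isConjCompatible_of_eq_localInvariantMap` / `isConjCompatible_canonical` — every family whose finite
  components are THE invariant maps is `IsConjCompatible σ`;
* `poitouTate_selmerStructure_duality_conj_of_canonical` — for `K` totally complex the five-conjunct
  named fact FOLLOWS from the two remaining printed properties of the canonical family
  (`UnramifiedOrthogonal`, Milne I Thm. 2.6, and `SelmerComplement`, Milne I Thm. 4.10(b) `⊇` /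
  Howard Thm. 2.1.11), the other three being kernel theorems.

PROOF of the compatibility (the source's remark «the canonical `K_𝔭`-isomorphism `L_𝔓 → L_{𝔓'}` …
trivially preserves the invariant map», Neukirch III §6; Serre in Cassels–Fröhlich VI §1.1
"functoriality of `inv`"), assembled from three tree theorems of other cells:
1. [AbsAnab] Prop. 1.2.1 (vii) PROVED (`galoisMLF_iso_residueMap_holds`, abc-iut): for local fields
   `K₁, K₂`, an isomorphism `α : G_{K₁} ≅ G_{K₂}` and an `α`-equivariant `ψ̄ : K̄₁ˣ ≅ K̄₂ˣ` carrying units to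
   units and uniformisers to uniformisers, the transport `cohTransport α (ψ̄|μ_N)` on `H²(·, μ_N)`
   intertwines the residue maps `invLevel`;
2. Frobenioids II Thm. 2.4 (ii) «field-isomorphism case» (`isAlphaEquivariant_unitsMapEquiv`,
   `preservesAbsUnits_unitsMapEquiv`, `preservesUniformizers_unitsMapEquiv`, abc-iut): for a VALUATIVE
   field isomorphism `φ₀ : K₁ ≅ K₂` with a lift `φ : K̄₁ ≅ K̄₂`, the pair (`galConjₜ φ₀ φ` = conjugation by
   `φ`, `ψ̄ = φ|ˣ`) has those three properties;
3. the Galois transport of completions `θ = σ_v : K_v ≅ K_w` (`galAdicCompletionEquiv`, tree) is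
   valuative (`valued_galAdicCompletionMap`), its chosen lift `Θ = ringEquivLift θ` and the adapted
   global lift `τ = liftAutPlace σ h` (`LiftsCommute τ Θ`) define `σ_*`;
and ONE identification proved here (`cohomologyMap_muLocalIso_muConjPlace`): transported to the local
coefficients `μ_N(K̄_v)`, `μ_N(K̄_w)` (`muLocalIso`), `σ_*` IS `cohTransport (galConjₜ θ Θ) (Θ|μ_N)` —
both are Mathlib's `ContinuousCohomology.map` along the compatible pair (`g ↦ Θ⁻¹ g Θ`, `ζ ↦ Θ ζ`)
(`ContinuousCohomology.map_comp` and `LiftsCommute`: `Θ ∘ ι_v = ι_w ∘ τ` on `K̄`).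

HONEST FRAMING: this strikes ONE of the five conjuncts of the named fact for the canonical family (and,
with bsd-cn100's theorems, three of five at a totally complex `K`); the existence half of Poitou–Tate
for Selmer structures (`SelmerComplement`) and the unramified orthogonality (`UnramifiedOrthogonal`)
remain named print.  Nothing here is specific to elliptic curves; no class of any census moves.

## References

* J. Neukirch, *Class Field Theory — the Bonn Lectures* (2013), Ch. III §6 (independence of the
  invariant map of the choice of `𝔓 ∣ 𝔭`). [Neukirch2013]
* J.-P. Serre, *Local class field theory*, Ch. VI of Cassels–Fröhlich (1967), §1.1 (functoriality of
  `inv`); J. Tate, Ch. VII §1.1 (`σ_w : L_w ≅ L_{σw}`). [CasselsFrohlichANT1967]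
* S. Mochizuki, *The absolute anabelian geometry of hyperbolic curves* (2004), Prop. 1.2.1 (vii).
  [MochizukiAbsAnab2004]
* S. Mochizuki, *The geometry of Frobenioids II*, Kyushu J. Math. 62 (2008), Thm. 2.4 (ii).
  [MochizukiFrdII2008]
* J. S. Milne, *Arithmetic Duality Theorems* (2006), I Cor. 2.3, Thm. 2.6, Thm. 4.10. [MilneADT2006]
-/

noncomputable section

open CategoryTheory Function NumberField IsDedekindDomain
open scoped NumberField

namespace Literature.NumberTheory.GaloisCohomology

open _root_.ContinuousCohomology
open Literature.NumberTheory.GaloisRepresentations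
open Literature.NumberTheory.GaloisRepresentations.DiscreteGaloisModule (mu MuCarrier)
open Literature.NumberTheory.EllipticCurves
open Literature.NumberTheory.Automorphic
open Literature.AnabelianGeometry.AbsoluteAnabelian
open Literature.AlgebraicGeometry.Frobenioids.PadicKummer

variable {K : Type} [Field K] [NumberField K] (σ : K ≃ₐ[ℚ] K) (N : ℕ) [NeZero N]
  {v w : HeightOneSpectrum (𝓞 K)} (h : σ • v = w)

/-! ### §1 The transport of completions is valuative -/

/-- **`σ_v : K_v ≅ K_w` identifies the valuation rings** (for the local-field structures of the
tree, `AdicCompletionLocalField`: `x ∈ 𝒪_{K_v} ↔ σ_v x ∈ 𝒪_{K_w}`), since it preserves `Valued.v`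
(`valued_galAdicCompletionMap`). [cite: CasselsFrohlichANT1967, Ch. VII §1.1] -/
theorem mem_integer_iff_galAdicCompletionEquiv (x : v.adicCompletion K) :
    x ∈ (ValuativeRel.valuation (v.adicCompletion K)).integer ↔
      galAdicCompletionEquiv (L := K) σ h x ∈ (ValuativeRel.valuation (w.adicCompletion K)).integer := by
  have h1 : x ∈ (ValuativeRel.valuation (v.adicCompletion K)).integer ↔ Valued.v x ≤ 1 := by
    rw [Valuation.mem_integer_iff, ← (ValuativeRel.valuation (v.adicCompletion K)).map_one,
      ← Valuation.vle_iff_le, Valuation.vle_iff_le (Valued.v), map_one]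
  have h2 : galAdicCompletionEquiv (L := K) σ h x ∈ (ValuativeRel.valuation (w.adicCompletion K)).integer ↔
      Valued.v (galAdicCompletionEquiv (L := K) σ h x) ≤ 1 := by
    rw [Valuation.mem_integer_iff, ← (ValuativeRel.valuation (w.adicCompletion K)).map_one,
      ← Valuation.vle_iff_le, Valuation.vle_iff_le (Valued.v), map_one]
  rw [h1, h2, coe_galAdicCompletionEquiv, valued_galAdicCompletionMap]

/-! ### §2 `σ_*` on `H²(K_v, μ_N)`, transported to `μ_N(K̄_v)`, is the anabelian `cohTransport` -/

/-- **`σ_* = cohTransport (galConjₜ σ_v Θ) (Θ|μ_N)` on `H²`, after `μ_N(K̄)|_{Γ_{K_v}} ≅ μ_N(K̄_v)`.**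
Both composites `H²(Γ_{K_v}, μ_N(K̄)|) → H²(Γ_{K_w}, μ_N(K̄_w))` are `ContinuousCohomology.map` along ONE
compatible pair (`map_comp`), and the pairs agree: on groups `g ↦ Θ⁻¹ g Θ` both times, on coefficients
`ι_w (τ ζ) = Θ (ι_v ζ)` (`LiftsCommute`). [cite: CasselsFrohlichANT1967, Ch. VII §1.1]
[cite: MochizukiAbsAnab2004, Prop 1.2.1 (vii) p.11] -/
theorem cohomologyMap_muLocalIso_muConjPlace
    (c : galoisCohomology ((mu K N).toLocal (Sum.inr v : Place K)) 2) :
    (cohomologyMap (muLocalIso w N).hom 2).hom (muConjPlace σ N h 2 c) =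
      Prop121vii.cohTransport
        (galConjₜ (galAdicCompletionEquiv (L := K) σ h) (ringEquivLift (galAdicCompletionEquiv (L := K) σ h))
          (isLiftOfRingEquiv_ringEquivLift (galAdicCompletionEquiv (L := K) σ h)))
        (mu (v.adicCompletion K) N) (mu (w.adicCompletion K) N)
        (Prop121vii.muCarrierMap
          (Units.mapEquiv (ringEquivLift (galAdicCompletionEquiv (L := K) σ h)).toMulEquiv).toMonoidHom N)
        (Prop121vii.isEquivariantOver_muCarrierMap
          (Def22Context.Iso.isAlphaEquivariant_unitsMapEquiv (galAdicCompletionEquiv (L := K) σ h)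
            (ringEquivLift (galAdicCompletionEquiv (L := K) σ h))
            (isLiftOfRingEquiv_ringEquivLift (galAdicCompletionEquiv (L := K) σ h))) N) 2
        ((cohomologyMap (muLocalIso v N).hom 2).hom c) := by
  -- abbreviations
  set θ := galAdicCompletionEquiv (L := K) σ h with hθdef
  have hΘ : IsLiftOfRingEquiv θ (ringEquivLift θ) := isLiftOfRingEquiv_ringEquivLift θ
  have hτ : IsLiftOfAut σ (liftAutPlace σ h) := isLiftOfAut_liftAutPlace σ h
  have hc : LiftsCommute (E := v.adicCompletion K) (E' := w.adicCompletion K) (liftAutPlace σ h)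
      (ringEquivLift θ) := liftsCommute_liftAutPlace σ h
  have hψ := Def22Context.Iso.isAlphaEquivariant_unitsMapEquiv θ (ringEquivLift θ) hΘ
  -- the two composites as ONE `ContinuousCohomology.map` each (objects made explicit so that the
  -- categorical composites are syntactically well typed)
  have hcomp :
      ContinuousCohomology.map hΘ.conjGalCMH
          (X := DiscreteGaloisModule.toTopRep (GaloisRep.restrictField (v.adicCompletion K) (mu K N)))
          (Y := DiscreteGaloisModule.toTopRep (GaloisRep.restrictField (w.adicCompletion K) (mu K N)))
          (semilinearLocalHom (ρ := mu K N) hτ hΘ hc (muSemilinearMap (liftAutPlace σ h) N)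
            (isSemilinear_mu hτ N)) 2 ≫
        ContinuousCohomology.map (ContinuousMonoidHom.id _)
          (X := DiscreteGaloisModule.toTopRep (GaloisRep.restrictField (w.adicCompletion K) (mu K N)))
          (Y := (mu (w.adicCompletion K) N).toTopRep) (resIdHom (muLocalIso w N).hom) 2 =
      ContinuousCohomology.map (ContinuousMonoidHom.id _)
          (X := DiscreteGaloisModule.toTopRep (GaloisRep.restrictField (v.adicCompletion K) (mu K N)))
          (Y := (mu (v.adicCompletion K) N).toTopRep) (resIdHom (muLocalIso v N).hom) 2 ≫
        (ContinuousCohomology.map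
            ((galConjₜ θ (ringEquivLift θ) hΘ).symm :
              Field.absoluteGaloisGroup (w.adicCompletion K) →ₜ*
                Field.absoluteGaloisGroup (v.adicCompletion K))
            (X := (mu (v.adicCompletion K) N).toTopRep)
            (Y := DiscreteGaloisModule.toTopRep (ContinuousRep.restrict (mu (v.adicCompletion K) N)
              ((galConjₜ θ (ringEquivLift θ) hΘ).symm :
                Field.absoluteGaloisGroup (w.adicCompletion K) →ₜ*
                  Field.absoluteGaloisGroup (v.adicCompletion K))))
            (TopRep.ofHom ⟨ContinuousLinearMap.id ℤ _, fun _ => rfl⟩) 2 ≫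
          ContinuousCohomology.map (ContinuousMonoidHom.id _)
            (X := DiscreteGaloisModule.toTopRep (ContinuousRep.restrict (mu (v.adicCompletion K) N)
              ((galConjₜ θ (ringEquivLift θ) hΘ).symm :
                Field.absoluteGaloisGroup (w.adicCompletion K) →ₜ*
                  Field.absoluteGaloisGroup (v.adicCompletion K))))
            (Y := (mu (w.adicCompletion K) N).toTopRep)
            (TopRep.ofHom ⟨(Prop121vii.intertwiningOfEquivariant (galConjₜ θ (ringEquivLift θ) hΘ)
                (mu (v.adicCompletion K) N) (mu (w.adicCompletion K) N)
                (Prop121vii.muCarrierMap (Units.mapEquiv (ringEquivLift θ).toMulEquiv).toMonoidHom N)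
                (Prop121vii.isEquivariantOver_muCarrierMap hψ N)).toContinuousLinearMap,
              (Prop121vii.intertwiningOfEquivariant (galConjₜ θ (ringEquivLift θ) hΘ)
                (mu (v.adicCompletion K) N) (mu (w.adicCompletion K) N)
                (Prop121vii.muCarrierMap (Units.mapEquiv (ringEquivLift θ).toMulEquiv).toMonoidHom N)
                (Prop121vii.isEquivariantOver_muCarrierMap hψ N)).isIntertwining'⟩) 2) := by
    rw [← ContinuousCohomology.map_comp, ← ContinuousCohomology.map_comp,
      ← ContinuousCohomology.map_comp]
    refine map_congr_of_eq (ContinuousMonoidHom.ext fun g => ?_) _ _ (fun m => ?_) 2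
    · -- groups: `Θ⁻¹ g Θ` on both sides
      apply AlgEquiv.ext
      intro x
      rfl
    · -- coefficients: `ι_w (τ ζ) = Θ (ι_v ζ)` on `μ_N(K̄)`
      apply muVal_injective (w.adicCompletion K) N
      apply Units.ext
      change (absClosureEmbedding K (w.adicCompletion K))
          (liftAutPlace σ h (muVal K N m : AlgebraicClosure K)) =
        ringEquivLift θ ((absClosureEmbedding K (v.adicCompletion K)) (muVal K N m : AlgebraicClosure K))
      exact (hc _).symm
  exact congrArg (fun T => TopModuleCat.Hom.hom T c) hcomp


/-! ### §3 `inv_w ∘ σ_* = inv_v` for THE invariant maps, and the fifth conjunct of the named fact -/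

/-- **THE local invariant maps are compatible with the Galois transport of completions**:
`inv_w (σ_* c) = inv_v c` for `σ ∈ Aut(K/ℚ)`, `σ • v = w` and `c ∈ H²(Γ_{K_v}, μ_N(K̄)|)`, where
`inv_v = localInvariantMap K N v` is THE residue map of `K_v` (on the localised coefficients) and
`σ_* = muConjPlace σ N h 2`. Proof: §2 and [AbsAnab] Prop. 1.2.1 (vii) (`galoisMLF_iso_residueMap_holds`)
for (`galConjₜ σ_v Θ`, `Θ|ˣ`), whose hypotheses are Frobenioids II Thm. 2.4 (ii)'s field-isomorphism
lemmas fed with §1. [cite: Neukirch2013, Ch. III §6] [cite: CasselsFrohlichANT1967, Ch. VI §1.1]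
[cite: MochizukiAbsAnab2004, Prop 1.2.1 (vii) p.11] -/
theorem localInvariantMap_muConjPlace (c : galoisCohomology ((mu K N).toLocal (Sum.inr v : Place K)) 2) :
    localInvariantMap K N w (muConjPlace σ N h 2 c) = localInvariantMap K N v c := by
  haveI : CharZero (v.adicCompletion K) := charZero_adicCompletion v
  haveI : CharZero (w.adicCompletion K) := charZero_adicCompletion w
  have hΘ : IsLiftOfRingEquiv (galAdicCompletionEquiv (L := K) σ h)
      (ringEquivLift (galAdicCompletionEquiv (L := K) σ h)) := isLiftOfRingEquiv_ringEquivLift _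
  have hO : ∀ x : v.adicCompletion K, x ∈ (ValuativeRel.valuation (v.adicCompletion K)).integer ↔
      galAdicCompletionEquiv (L := K) σ h x ∈ (ValuativeRel.valuation (w.adicCompletion K)).integer :=
    mem_integer_iff_galAdicCompletionEquiv σ h
  have hres := galoisMLF_iso_residueMap_holds (v.adicCompletion K) (w.adicCompletion K)
    (galConjₜ (galAdicCompletionEquiv (L := K) σ h) (ringEquivLift (galAdicCompletionEquiv (L := K) σ h)) hΘ)
    (Units.mapEquiv (ringEquivLift (galAdicCompletionEquiv (L := K) σ h)).toMulEquiv) N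
    (Def22Context.Iso.isAlphaEquivariant_unitsMapEquiv (galAdicCompletionEquiv (L := K) σ h)
      (ringEquivLift (galAdicCompletionEquiv (L := K) σ h)) hΘ)
    (Def22Context.Iso.preservesAbsUnits_unitsMapEquiv (galAdicCompletionEquiv (L := K) σ h)
      (ringEquivLift (galAdicCompletionEquiv (L := K) σ h)) hΘ hO)
    (Def22Context.Iso.preservesUniformizers_unitsMapEquiv (galAdicCompletionEquiv (L := K) σ h)
      (ringEquivLift (galAdicCompletionEquiv (L := K) σ h)) hΘ hO)
    (Prop121vii.invLevel (v.adicCompletion K) N) (Prop121vii.invLevel (w.adicCompletion K) N)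
    (Prop121vii.isInvariantMap_invLevel (v.adicCompletion K) N)
    (Prop121vii.isInvariantMap_invLevel (w.adicCompletion K) N)
  rw [localInvariantMap_apply, localInvariantMap_apply, cohomologyMap_muLocalIso_muConjPlace]
  conv_rhs => rw [← hres]
  rfl

/-- **Every family of local invariant maps whose finite components are THE invariant maps is
compatible with `σ_*`** (`LocalInvariants.IsConjCompatible σ`), for every `σ ∈ Aut(K/ℚ)`.
[cite: Neukirch2013, Ch. III §6] [cite: CasselsFrohlichANT1967, Ch. VI §1.1] -/
theorem isConjCompatible_of_eq_localInvariantMap (inv : LocalInvariants K N)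
    (hinv : ∀ u : HeightOneSpectrum (𝓞 K), inv (Sum.inr u) = localInvariantMap K N u) :
    inv.IsConjCompatible σ := by
  intro v w h c
  rw [hinv, hinv, localInvariantMap_muConjPlace]

/-- **The canonical family `LocalInvariants.canonical K N` is compatible with `σ_*`** for every
`σ ∈ Aut(K/ℚ)` — the fifth conjunct of `poitouTate_selmerStructure_duality_conj` for THE invariant maps.
[cite: Neukirch2013, Ch. III §6] [cite: CasselsFrohlichANT1967, Ch. VI §1.1] -/
theorem isConjCompatible_canonical : (LocalInvariants.canonical K N).IsConjCompatible σ :=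
  isConjCompatible_of_eq_localInvariantMap σ N _ fun _ => rfl

/-- **The five-conjunct named fact from the two remaining printed properties of the canonical family**,
`K` totally complex: `IsPerfect` (`canonical_isPerfect`, Milne I Cor. 2.3), the reciprocity law
(`sumInvLocalizationEqZero_canonical_of_correction` + `exists_correction_trivial_above_p`, Tate, C–F VII
§11; hence `SumLocalTermEqZero`) and `IsConjCompatible` (this file) are KERNEL THEOREMS; what remains
of `poitouTate_selmerStructure_duality_conj K` is the unramified orthogonality (Milne I Thm. 2.6) and the
existence half of Poitou–Tate for Selmer structures (Milne I Thm. 4.10(b) `⊇`, Howard Thm. 2.1.11) FOR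
THE CANONICAL FAMILY — the hypothesis `hUS`. [cite: MilneADT2006, Ch. I, Thm. 4.10(b)]
[cite: CasselsFrohlichANT1967, Ch. VII §11] -/
theorem poitouTate_selmerStructure_duality_conj_of_canonical (K : Type) [Field K] [NumberField K]
    [IsTotallyComplex K]
    (hUS : ∀ (n : ℕ) [NeZero n], (LocalInvariants.canonical K n).UnramifiedOrthogonal ∧
      (LocalInvariants.canonical K n).SelmerComplement) :
    poitouTate_selmerStructure_duality_conj K := by
  intro n _
  obtain ⟨hUO, hSC⟩ := hUS n
  exact ⟨LocalInvariants.canonical K n, LocalInvariants.canonical_isPerfect,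
    LocalInvariants.sumLocalTermEqZero_of_sumInvLocalizationEqZero _
      (sumInvLocalizationEqZero_canonical_of_correction K
        (fun p _ m y S hS => exists_correction_trivial_above_p K p m y S hS) n),
    hUO, hSC, fun σ => isConjCompatible_canonical σ n⟩

/-! ### §4 (appended) Every number field: the named fact from the two remaining printed properties -/

/-- **The five-conjunct named fact `poitouTate_selmerStructure_duality_conj K` for EVERY number field
`K : Type` from the two remaining printed properties of THE canonical family** — `UnramifiedOrthogonal`
(Milne I Thm. 2.6) and `SelmerComplement` (Milne I Thm. 4.10(b) `⊇` / Howard Thm. 2.1.11): the other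
three conjuncts are KERNEL THEOREMS at every number field — `IsPerfect` (`canonical_isPerfect`), the
reciprocity law `∑_v inv_v = 0` (`sumInvLocalizationEqZero_canonical_of_numberField`, Tate, C–F VII §11,
cell bsd-cn100, every `K`) and `IsConjCompatible` (`isConjCompatible_canonical`, this file). Consumers
displaying `hPT : ∀ K, poitouTate_selmerStructure_duality_conj K` are fed by
`fun K _ _ => poitouTate_selmerStructure_duality_conj_of_canonical_numberField K (hUO K) (hSC K)`.
[cite: MilneADT2006, Ch. I, Thm. 2.6 and Thm. 4.10(b)] [cite: CasselsFrohlichANT1967, Ch. VII §11]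
[cite: Neukirch2013, Ch. III §6] -/
theorem poitouTate_selmerStructure_duality_conj_of_canonical_numberField (K : Type) [Field K]
    [NumberField K]
    (hUO : ∀ (n : ℕ) [NeZero n], (LocalInvariants.canonical K n).UnramifiedOrthogonal)
    (hSC : ∀ (n : ℕ) [NeZero n], (LocalInvariants.canonical K n).SelmerComplement) :
    poitouTate_selmerStructure_duality_conj K := fun n _ =>
  ⟨LocalInvariants.canonical K n, LocalInvariants.canonical_isPerfect,
    LocalInvariants.sumLocalTermEqZero_of_sumInvLocalizationEqZero _
      (sumInvLocalizationEqZero_canonical_of_numberField K n),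
    hUO n, hSC n, fun σ => isConjCompatible_canonical σ n⟩

/-- The same for the four-conjunct fact `poitouTate_selmerStructure_duality K` (forget the fifth).
[cite: MilneADT2006, Ch. I, Thm. 2.6 and Thm. 4.10(b)] -/
theorem poitouTate_selmerStructure_duality_of_canonical_numberField (K : Type) [Field K] [NumberField K]
    (hUO : ∀ (n : ℕ) [NeZero n], (LocalInvariants.canonical K n).UnramifiedOrthogonal)
    (hSC : ∀ (n : ℕ) [NeZero n], (LocalInvariants.canonical K n).SelmerComplement) :
    poitouTate_selmerStructure_duality K :=
  poitouTate_selmerStructure_duality_of_conj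
    (poitouTate_selmerStructure_duality_conj_of_canonical_numberField K hUO hSC)

end Literature.NumberTheory.GaloisCohomology

end
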